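import Literature.IUT.HodgeArakelov.BadPrimeGaussianMonoidsCor36GenuineRecordThirdDisplay
import Literature.IUT.HodgeArakelov.TemperedThetaMonoidsProofs4

/-!
# [IUTchII] Cor 3.6 (ii) third display at the genuine `θ_env` data from ONE KUMMER MAP of the tempered Frobenioid
# (Prop 3.3 (i) «by forming Kummer classes relative to the Frobenioid structure of `†F_v`») — proof-only sequel of
# `…Cor36GenuineRecordThirdDisplay` replacing the packaged `†F^Θ_v`-side datum `K` by its print-shaped source `k`

S. Mochizuki, *Inter-universal Teichmüller theory II*, kurims Dec-2020 manuscript, Cor 3.6 (ii) p. 100 l. 26–60 (third display),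
Prop 3.3 (i) p. 90 l. 28–61 («By forming Kummer classes relative to the Frobenioid structure of `†F_v` … collections of
isomorphisms of monoids `Ψ_{†F^Θ_v,α} ⥲ Ψ^ι_env(M^Θ_*)`»), Ex 3.2 (i) pp. 88–89 (`Ψ_{†F^Θ_v,α} := 𝒪^×_{C^Θ_v}·(Θ^α_v)^ℕ`),
Cor 3.5 (ii) p. 95, Cor 2.8 (i) p. 82; [FrdII] Def 2.1 (ii) / [EtTh] §5 (Kummer classes of a Frobenioid)
[cite: Mochizuki2012, Cor 3.6 (ii) p.100]. Claim key DISPUTED (D-0012); nothing disputed is asserted here. PROOF-ONLY companion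
(abc-iut cell, layer L6, seat abc-iut-w5-d192 gen 4; node **IUTchII:Cor3.6(ii)**, sub-DAG row Cor-36.ii.r10 with junctions J6/J8 of
SUBDAG-IUTchII-Prop-31-33-34). NO definition, NO `Prop` fact, NO instance.

WHAT IS PROVED. In `…Cor36GenuineRecordThirdDisplay` (p436899) the `†F^Θ_v`-side input of the third display is abc-iut-L6-t2's
PACKAGED datum `K : Prop33KummerStatements (genuine record) F` (label map + four isomorphisms). Print's input is ONE Kummer map
of the tempered Frobenioid (Prop 3.3 (i); junction J6 of the W6-S6 sub-DAG), from which abc-iut-w5-d169's J8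
(`TemperedThetaMonoids.map_frobThetaMonoid_eq_thetaMonoid` / `exists_prop33KummerStatements_of_kummer`, p414222) builds `K`.
HERE the third display is stated DIRECTLY over such a map, at the genuine `θ_env` data over `ℚ̄_pˣ` (any inversion family):
* **`exists_transportIso_toRecord_padic_of_kummerMap_of_evaluation`** — for a Frobenioid-side datum `F` over `Π^tp_{X̲̲}`
  (abc-iut-L6-t2 `TemperedFrobenioidThetaData`: `𝒪^×(T^÷_{A^Θ_∞})`, its `Π_v`-action, `𝒪^×_{C^Θ_v}`, `Θ_v`) and ONE INJECTIVE
  homomorphism `k : 𝒪^×(T^÷_{A^Θ_∞}) → lim_J H¹(Π^tp_{Ÿ̲̲} ∩ J, l·Δ_Θ)` carrying `𝒪^×_{C^Θ_v}` ONTO `M^×_TM` with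
  `k(Θ^α_v) ∈ θ^{i₀}_env(𝕄_*)` (its class IS an `ι`-invariant theta class — [EtTh] Prop 1.3 / Def 1.9) and `horb`, and for
  ANY Kummer copy `e : N ⥲ κ₀(O)` of the labeled constants: an isomorphism `Φ : Ψ_{†F^Θ_v,α} ⥲ Ψ_{Fξ}(†F_v)` onto the
  Frobenioid-theoretic Gaussian monoid which, read through the labeled copies, IS `x ↦ (R_t (k x))_t` — «restriction ∘
  Kummer map»; the restriction isomorphism and ALL its §3 junction hypotheses come from abc-iut-w4-d004's
  `exists_unique_restrictionIso'_toRecord_padic_of_evaluation` (p434055; print-shaped evaluation inputs), the theta-monoid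
  identification `k(Ψ_{†F^Θ_v,α}) = Ψ^{i₀}_env(𝕄_*)` from J8 with its containment hypothesis DERIVED from `horb`;
* `…_of_kummerMap_of_evaluation_self` — the same with `(Ψ_{†C_v})` read as `O` and the Kummer copy `κ₀` itself.
Residual inputs of row Cor-36.ii.r10 at the genuine record after this file = DATA only: the Frobenioid-side datum `F` with its
Kummer map `k` (J6: [FrdII] Thm 2.4 / [EtTh] §5, layers L1/L2/L5), the [EtTh] §1 sections/evaluations/presentation/values data,
the raw orbit clause of Prop 2.2 (ii) (`horb_toRecord_family_of_orbit`), the model data.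
HONEST FRAMING: composition of landed theorems; no side taken on [IUTchIII] Cor 3.12; typed ≠ proved ≠ endorsed.
-/

noncomputable section

namespace Literature.IUT.HodgeArakelov

namespace BadPrimeGaussianMonoids

/-! ### §0. Generic: transport of a pinned isomorphism onto the Frobenioid-theoretic copy (Proofs4's composite with the
Kummer isomorphism `Ψ_{†F^Θ_v,α} ⥲ Ψ^ι_env` as a bare datum `eK`) -/

/-- abc-iut-w4-d004's `exists_kummerRestrictionTransportIso'` (Proofs4) with the `†F^Θ_v`-side Kummer isomorphism given as
ANY isomorphism `eK : S₁ ⥲ S₂` onto the source of the restriction isomorphism `eΨ : S₂ ⥲ Ψ_ξ` (pinned to `r`): the composite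
`S₁ ⥲ Ψ_{Fξ} := (∏_t e)⁻¹(Ψ_ξ)` exists and, read through the labeled Kummer copies `piIso T e`, IS `r ∘ eK` ([IUTchII] Cor 3.6
(ii) p. 100 third display «by composing the Kummer isomorphisms … with the restriction isomorphisms»).
[cite: Mochizuki2012, Cor 3.6 (ii) p.100] -/
theorem exists_transportIso_of_pinnedIso {T : Type*} {M : Type*} [CommMonoid M] {N : Type*} [CommMonoid N]
    {S₁ : Type*} {S₂ : Type*} [MulOneClass S₁] [MulOneClass S₂]
    (eK : S₁ ≃* S₂) (r : S₂ → (T → M)) {ξ : T → M}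
    (eΨ : S₂ ≃* gaussianMonoid ξ) (heΨ : ∀ y, ((eΨ y : gaussianMonoid ξ) : T → M) = r y) (e : N ≃* M) :
    ∃ Φ : S₁ ≃* frobenioidGaussianMonoid e ξ,
      ∀ x, piIso T e ((Φ x : frobenioidGaussianMonoid e ξ) : T → N) = r (eK x) := by
  have hmap : (frobenioidGaussianMonoid e ξ).map (piIso T e : (T → N) →* (T → M)) = gaussianMonoid ξ := by
    rw [frobenioidGaussianMonoid, MulEquiv.toMonoidHom_eq_coe, Submonoid.map_comap_eq_of_surjective]
    exact (piIso T e).surjective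
  let ψ : frobenioidGaussianMonoid e ξ ≃* gaussianMonoid ξ :=
    ((piIso T e).submonoidMap (frobenioidGaussianMonoid e ξ)).trans (MulEquiv.submonoidCongr hmap)
  have hψ : ∀ x, ((ψ x : gaussianMonoid ξ) : T → M) = piIso T e x := fun x => rfl
  refine ⟨eK.trans (eΨ.trans ψ.symm), fun x => ?_⟩
  rw [MulEquiv.trans_apply, MulEquiv.trans_apply, ← hψ, MulEquiv.apply_symm_apply, heΨ]

end BadPrimeGaussianMonoids

namespace EtaleLevels

open Literature.AnabelianGeometry.EtaleTheta CohomologySystemOfContH1 EtaleThetaDataOfSetting TemperedThetaMonoids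
  BadPrimeGaussianMonoids

variable {p : ℕ} [Fact p.Prime] {D : Literature.AnabelianGeometry.EtaleTheta.ThetaSetting p}
  {E : D.EtaleThetaData} {l : ℕ} (C : E.DoubleUnderline l) (hC : D.Compat) (hS : D.Sec2Hyps)
  (hl : l.Prime) (hp2 : p ≠ 2) (hpl : p ≠ l) (hζ : ∃ ζ : D.K, IsPrimitiveRoot ζ (4 * l))
  (mods : ∀ M : ℕ+, D.CyclotomeMod l M)
  (f : contCocycles D.toTheta D.DeltaTheta C.GtpYdduu) (hf : f ∈ C.rootCocycles hC)
  (hmods : ∀ (M M' : ℕ+) (h : (M : ℕ) ∣ (M' : ℕ)) (x : D.lDeltaTheta l),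
    MuN.red p M M' h ((mods M').red x) = (mods M).red x)
  (h15 : Literature.AnabelianGeometry.EtaleTheta.ThetaSetting.Prop15iii E hC) (L : C.CuspLabels)
  (hZ : ∀ M : ℕ+, Nonempty (ModelCyclotomes.lDeltaQuot (C.rigidData (mods M) hC hS h15 L) ≃*
    Literature.IUT.HodgeTheaters.ZHat))
  (hcharY : EtaleThetaDataOfSetting.PiYddCharacteristic C)
  (hlim : Function.Bijective (rigidLimHom C hC hS hl hp2 hpl hζ mods f hf hmods h15 L hZ))
  [(EtaleThetaDataOfSetting.PiYdd C).Normal]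
  {Iota : Type}
  (iota : Iota → ((thetaEnvData C hC hS hl hp2 hpl hζ mods f hf hmods h15 L hZ hcharY hlim).D.coh.lim ≃+
    (thetaEnvData C hC hS hl hp2 hpl hζ mods f hf hmods h15 L hZ hcharY hlim).D.coh.lim))
  {Lbl : Type*} {P₀ : TopGroup.{0}} (φ₀ : P₀ →* D.GtpTheta) (s : Lbl → (P₀ →* Pi C))
  (hι : ∀ t, Continuous ((MonoidHom.id (Pi C)).comp (s t)))
  (hN : ∀ t, (⊤ : Subgroup P₀).map ((MonoidHom.id (Pi C)).comp (s t)) ≤ PiYdd C)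
  (hφ : ∀ t, (phi C).comp ((MonoidHom.id (Pi C)).comp (s t)) = φ₀)
  [TopologicalSpace (PadicAlgCl p)ˣ]
  (c : CyclotomeCoefficients (phi C) (D.lDeltaTheta l) (PadicAlgCl p)ˣ)
  (hA : ∀ b : (PadicAlgCl p)ˣ, IsOpen (MulAction.stabilizer (Pi C) b : Set (Pi C)))
  (hfi : ∀ b : (PadicAlgCl p)ˣ, (MulAction.stabilizer (Pi C) b).FiniteIndex)
  (O : Submonoid (PadicAlgCl p)ˣ)
  [MulDistribMulAction P₀ (PadicAlgCl p)ˣ]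
  (c₀ : CyclotomeCoefficients φ₀ (D.lDeltaTheta l) (PadicAlgCl p)ˣ)
  (hA₀ : ∀ b : (PadicAlgCl p)ˣ, IsOpen (MulAction.stabilizer P₀ b : Set P₀))
  (hfi₀ : ∀ b : (PadicAlgCl p)ˣ, (MulAction.stabilizer P₀ b).FiniteIndex)
  {Afun : Type} [CommGroup Afun] [MulDistribMulAction (Pi C) Afun] [TopologicalSpace Afun] [RootableBy Afun ℕ]
  (cf : CyclotomeCoefficients (phi C) (D.lDeltaTheta l) Afun)
  (hAf : ∀ a : Afun, IsOpen (MulAction.stabilizer (Pi C) a : Set (Pi C)))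
  (hfif : ∀ a : Afun, (MulAction.stabilizer (Pi C) a).FiniteIndex)

/-- **[Cor-36.ii.r10] the third display `Ψ_{†F^Θ_v,α} ⥲ Ψ^ι_env(𝕄_*) ⥲ Ψ_ξ(𝕄_*) ⥲ Ψ_{Fξ}(†F_v)` at the genuine `θ_env` data over
`ℚ̄_pˣ` from ONE KUMMER MAP `k` of the tempered Frobenioid** ([IUTchII] Cor 3.6 (ii) p. 100 l. 26–60 with Prop 3.3 (i) p. 90 «by
forming Kummer classes relative to the Frobenioid structure of `†F_v`»): for `F = (𝒪^×(T^÷_{A^Θ_∞}), Π_v ↷, 𝒪^×_{C^Θ_v}, Θ_v)`,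
`k` injective with `k(𝒪^×_{C^Θ_v}) = M^×_TM`, `k(Θ^α_v) ∈ θ^{i₀}_env(𝕄_*)` and `horb`, and any Kummer copy `e : N ⥲ κ₀(O)`, there is
`Φ : Ψ_{†F^Θ_v,α} ⥲ Ψ_{Fξ}(†F_v)`, `ξ = (R_t k(Θ^α_v))_t`, with `(e ∘ Φ(x))_t = R_t (k x)` — the restriction isomorphism being
abc-iut-w4-d004's `exists_unique_restrictionIso'_toRecord_padic_of_evaluation` (every §3 junction hypothesis DERIVED from the
evaluation sections, the model data, the presentation `k(Θ^α_v) = κ_fun(fΘ)` and the values `ev_t fΘ = q_t ∈ O`, `q_{t₀}`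
non-unit) and `k(Ψ_{†F^Θ_v,α}) = Ψ^{i₀}_env(𝕄_*)` being abc-iut-w5-d169's J8 `map_frobThetaMonoid_eq_thetaMonoid`.
[cite: Mochizuki2012, Cor 3.6 (ii) p.100] -/
theorem exists_transportIso_toRecord_padic_of_kummerMap_of_evaluation (hc : Function.Bijective c.hom)
    (hc₀ : Function.Bijective c₀.hom) (hc₀c : ∀ ζ, c₀.hom ζ = c.hom ζ)
    (hact : ∀ (t : Lbl) (g : P₀) (a : (PadicAlgCl p)ˣ), g • a = s t g • a) (t₁ : Lbl)
    [((EtaleThetaDataOfSetting.aug C).comp (s t₁)).range.FiniteIndex]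
    (F : TemperedFrobenioidThetaData.{0, 0} (modelSystem C hC hS hl hp2 hpl hζ mods f hf hmods h15 L hZ).PiX)
    (k : F.K →* ((thetaEnvData C hC hS hl hp2 hpl hζ mods f hf hmods h15 L hZ hcharY hlim).toRecord
          (h1LimConjMulAut (phi C) (D.lDeltaTheta l) (PiYdd C))
          (h1LimKummerOn (phi C) (D.lDeltaTheta l) (PiYdd C) c hA hfi O) iota).H)
    (hk : Function.Injective k)
    (hU : F.units.toSubmonoid.map k = ((thetaEnvData C hC hS hl hp2 hpl hζ mods f hf hmods h15 L hZ hcharY hlim).toRecord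
          (h1LimConjMulAut (phi C) (D.lDeltaTheta l) (PiYdd C))
          (h1LimKummerOn (phi C) (D.lDeltaTheta l) (PiYdd C) c hA hfi O) iota).units.toSubmonoid)
    (α : (modelSystem C hC hS hl hp2 hpl hζ mods f hf hmods h15 L hZ).PiX) {i₀ : Iota}
    (hθ : (k (F.conj α F.theta)) ∈ ((thetaEnvData C hC hS hl hp2 hpl hζ mods f hf hmods h15 L hZ hcharY hlim).toRecord
          (h1LimConjMulAut (phi C) (D.lDeltaTheta l) (PiYdd C))
          (h1LimKummerOn (phi C) (D.lDeltaTheta l) (PiYdd C) c hA hfi O) iota).thetaEnv i₀)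
    (horb : ∀ θ' ∈ ((thetaEnvData C hC hS hl hp2 hpl hζ mods f hf hmods h15 L hZ hcharY hlim).toRecord
          (h1LimConjMulAut (phi C) (D.lDeltaTheta l) (PiYdd C))
          (h1LimKummerOn (phi C) (D.lDeltaTheta l) (PiYdd C) c hA hfi O) iota).thetaEnv i₀,
      ∃ u ∈ ((thetaEnvData C hC hS hl hp2 hpl hζ mods f hf hmods h15 L hZ hcharY hlim).toRecord
          (h1LimConjMulAut (phi C) (D.lDeltaTheta l) (PiYdd C))
          (h1LimKummerOn (phi C) (D.lDeltaTheta l) (PiYdd C) c hA hfi O) iota).units, θ' = u * (k (F.conj α F.theta)))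
    (R : Lbl → (((thetaEnvData C hC hS hl hp2 hpl hζ mods f hf hmods h15 L hZ hcharY hlim).toRecord
          (h1LimConjMulAut (phi C) (D.lDeltaTheta l) (PiYdd C))
          (h1LimKummerOn (phi C) (D.lDeltaTheta l) (PiYdd C) c hA hfi O) iota).H →*
      Multiplicative (h1Lim φ₀ (D.lDeltaTheta l) (⊤ : Subgroup P₀) ⊥)))
    (hR : ∀ t y, Multiplicative.toAdd (R t y) =
      h1LimCongr (D.lDeltaTheta l) ⊤ (hφ t) ⊥
        (h1LimComap (phi C) (D.lDeltaTheta l) ((MonoidHom.id (Pi C)).comp (s t)) (hι t) (hN t)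
          (AddEquiv.additiveMultiplicative (h1Lim (phi C) (D.lDeltaTheta l) (PiYdd C) ⊥) (Additive.ofMul y))))
    (ev : Lbl → (Afun →* (PadicAlgCl p)ˣ)) (hev : ∀ (t : Lbl) (g : P₀) (a : Afun), ev t (s t g • a) = g • ev t a)
    (hcev : ∀ (t : Lbl) (ζ : cyclotome Afun), c₀.hom (cyclotome.map (ev t) ζ) = cf.hom ζ)
    {fΘ : Afun}
    (hθf : AddEquiv.additiveMultiplicative (h1Lim (phi C) (D.lDeltaTheta l) (PiYdd C) ⊥) (Additive.ofMul (k (F.conj α F.theta))) =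
      Multiplicative.toAdd (h1LimKummer (phi C) (D.lDeltaTheta l) (PiYdd C) cf hAf hfif fΘ))
    (q : Lbl → O) (hval : ∀ t, ev t fΘ = (q t : (PadicAlgCl p)ˣ)) (t₀ : Lbl) (hq : ¬ IsUnit (q t₀))
    {N : Type*} [CommMonoid N] (e : N ≃* MonoidHom.mrange (h1LimKummerOn φ₀ (D.lDeltaTheta l) ⊤ c₀ hA₀ hfi₀ O)) :
    ∃ Φ : F.frobThetaMonoid α ≃*
        frobenioidGaussianMonoid e (fun t =>
          (fun t =>
          ((R t).comp (((thetaEnvData C hC hS hl hp2 hpl hζ mods f hf hmods h15 L hZ hcharY hlim).toRecord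
          (h1LimConjMulAut (phi C) (D.lDeltaTheta l) (PiYdd C))
          (h1LimKummerOn (phi C) (D.lDeltaTheta l) (PiYdd C) c hA hfi O) iota).thetaMonoid i₀).subtype).codRestrict
            (MonoidHom.mrange (h1LimKummerOn φ₀ (D.lDeltaTheta l) ⊤ c₀ hA₀ hfi₀ O))
            (restriction_mem_mrange_gen
              ((thetaEnvData C hC hS hl hp2 hpl hζ mods f hf hmods h15 L hZ hcharY hlim).toRecord
          (h1LimConjMulAut (phi C) (D.lDeltaTheta l) (PiYdd C))
          (h1LimKummerOn (phi C) (D.lDeltaTheta l) (PiYdd C) c hA hfi O) iota)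
              (h1LimKummerOn (phi C) (D.lDeltaTheta l) (PiYdd C) c hA hfi O)
              (h1LimKummerOn φ₀ (D.lDeltaTheta l) ⊤ c₀ hA₀ hfi₀ O)
              (fun t => (R t).comp (((thetaEnvData C hC hS hl hp2 hpl hζ mods f hf hmods h15 L hZ hcharY hlim).toRecord
          (h1LimConjMulAut (phi C) (D.lDeltaTheta l) (PiYdd C))
          (h1LimKummerOn (phi C) (D.lDeltaTheta l) (PiYdd C) c hA hfi O) iota).thetaMonoid i₀).subtype)
              q (hκ_padic C c hA hfi O hc) (ThetaEnvData.toRecord_constantMonoid _ _ _ _) hθ horb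
              (fun t m hm => hRκ_toRecord C hC hS hl hp2 hpl hζ mods f hf hmods h15 L hZ hcharY hlim iota φ₀ s hι hN hφ c
                hA hfi O c₀ hA₀ hfi₀ hc₀c hact R hR t m hm)
              (fun t => hRθ_toRecord_of_evaluation C hC hS hl hp2 hpl hζ mods f hf hmods h15 L hZ hcharY hlim iota φ₀ s hι hN
                hφ c hA hfi O c₀ hA₀ hfi₀ cf hAf hfif R hR ev hev hcev hθf q hval t) t)) t
            ⟨(k (F.conj α F.theta)), thetaEnv_subset_thetaMonoid
              ((thetaEnvData C hC hS hl hp2 hpl hζ mods f hf hmods h15 L hZ hcharY hlim).toRecord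
          (h1LimConjMulAut (phi C) (D.lDeltaTheta l) (PiYdd C))
          (h1LimKummerOn (phi C) (D.lDeltaTheta l) (PiYdd C) c hA hfi O) iota) i₀ hθ⟩),
      ∀ (x : F.frobThetaMonoid α) (t : Lbl),
        ((piIso Lbl e ((Φ x : frobenioidGaussianMonoid e _) : Lbl → N) t :
            MonoidHom.mrange (h1LimKummerOn φ₀ (D.lDeltaTheta l) ⊤ c₀ hA₀ hfi₀ O)) : Multiplicative (h1Lim φ₀ (D.lDeltaTheta l) (⊤ : Subgroup P₀) ⊥)) =
          R t (k x) := by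
  -- J8: `k(Ψ_{†F^Θ_v,α}) = Ψ^{i₀}_env(𝕄_*)`, its containment hypothesis from `horb`
  have hθ' : ((thetaEnvData C hC hS hl hp2 hpl hζ mods f hf hmods h15 L hZ hcharY hlim).toRecord
          (h1LimConjMulAut (phi C) (D.lDeltaTheta l) (PiYdd C))
          (h1LimKummerOn (phi C) (D.lDeltaTheta l) (PiYdd C) c hA hfi O) iota).thetaEnv i₀ ⊆
      (splitMonoid ((thetaEnvData C hC hS hl hp2 hpl hζ mods f hf hmods h15 L hZ hcharY hlim).toRecord
          (h1LimConjMulAut (phi C) (D.lDeltaTheta l) (PiYdd C))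
          (h1LimKummerOn (phi C) (D.lDeltaTheta l) (PiYdd C) c hA hfi O) iota).units (Submonoid.powers (k (F.conj α F.theta))) : Set _) := by
    intro θ' hθ'₀
    obtain ⟨u, hu, rfl⟩ := horb θ' hθ'₀
    exact (mem_splitMonoid_iff _ _ _).2 ⟨u, hu, _, Submonoid.mem_powers _, rfl⟩
  have hmap := map_frobThetaMonoid_eq_thetaMonoid
    ((thetaEnvData C hC hS hl hp2 hpl hζ mods f hf hmods h15 L hZ hcharY hlim).toRecord
          (h1LimConjMulAut (phi C) (D.lDeltaTheta l) (PiYdd C))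
          (h1LimKummerOn (phi C) (D.lDeltaTheta l) (PiYdd C) c hA hfi O) iota) F k hU α i₀ hθ hθ'
  -- the Kummer isomorphism `Ψ_{†F^Θ_v,α} ⥲ Ψ^{i₀}_env` induced by `k`
  let eF : F.frobThetaMonoid α ≃* ((thetaEnvData C hC hS hl hp2 hpl hζ mods f hf hmods h15 L hZ hcharY hlim).toRecord
          (h1LimConjMulAut (phi C) (D.lDeltaTheta l) (PiYdd C))
          (h1LimKummerOn (phi C) (D.lDeltaTheta l) (PiYdd C) c hA hfi O) iota).thetaMonoid i₀ :=
    ((F.frobThetaMonoid α).equivMapOfInjective (k : F.K →* _) hk).trans (MulEquiv.submonoidCongr hmap)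
  have heF : ∀ x : F.frobThetaMonoid α, ((eF x : ((thetaEnvData C hC hS hl hp2 hpl hζ mods f hf hmods h15 L hZ hcharY hlim).toRecord
          (h1LimConjMulAut (phi C) (D.lDeltaTheta l) (PiYdd C))
          (h1LimKummerOn (phi C) (D.lDeltaTheta l) (PiYdd C) c hA hfi O) iota).thetaMonoid i₀) : ((thetaEnvData C hC hS hl hp2 hpl hζ mods f hf hmods h15 L hZ hcharY hlim).toRecord
          (h1LimConjMulAut (phi C) (D.lDeltaTheta l) (PiYdd C))
          (h1LimKummerOn (phi C) (D.lDeltaTheta l) (PiYdd C) c hA hfi O) iota).H) = k x := fun _ => rfl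
  -- Cor 3.5 (ii) restriction isomorphism at the genuine data, every junction hypothesis derived (abc-iut-w4-d004)
  obtain ⟨eΨ, heΨ, -⟩ :=
    exists_unique_restrictionIso'_toRecord_padic_of_evaluation C hC hS hl hp2 hpl hζ mods f hf hmods h15 L hZ hcharY hlim iota φ₀ s hι hN hφ c hA hfi O c₀ hA₀ hfi₀ cf hAf
      hfif hc hc₀ hc₀c hact t₁ hθ horb R hR ev hev hcev hθf q hval t₀ hq
  -- transport onto the Frobenioid-theoretic copy along the labeled Kummer copies (§0)
  obtain ⟨Φ, hΦ⟩ := exists_transportIso_of_pinnedIso eF _ eΨ heΨ e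
  refine ⟨Φ, fun x t => ?_⟩
  rw [congrFun (hΦ x) t]
  exact congrArg (R t) (heF x)

/-- **The same with `(Ψ_{†C_v})` READ AS `O` itself** and the Kummer copy = the `G_v`-level Kummer map `κ₀` onto its image
(injective: abc-iut-w4-d004 `hκ₀_padic`); J5 of SUBDAG-IUTchII-Prop-31-33-34 for the genuine `†F_v`. The composite
`Φ : Ψ_{†F^Θ_v,α} ⥲ Ψ_{Fξ}(†F_v) ⊆ ∏_t O` then satisfies `κ₀((Φ x)_t) = R_t (k x)`: «restriction ∘ Kummer map» on the nose.
[cite: Mochizuki2012, Cor 3.6 (ii) p.100] -/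
theorem exists_transportIso_toRecord_padic_of_kummerMap_of_evaluation_self (hc : Function.Bijective c.hom)
    (hc₀ : Function.Bijective c₀.hom) (hc₀c : ∀ ζ, c₀.hom ζ = c.hom ζ)
    (hact : ∀ (t : Lbl) (g : P₀) (a : (PadicAlgCl p)ˣ), g • a = s t g • a) (t₁ : Lbl)
    [((EtaleThetaDataOfSetting.aug C).comp (s t₁)).range.FiniteIndex]
    (F : TemperedFrobenioidThetaData.{0, 0} (modelSystem C hC hS hl hp2 hpl hζ mods f hf hmods h15 L hZ).PiX)
    (k : F.K →* ((thetaEnvData C hC hS hl hp2 hpl hζ mods f hf hmods h15 L hZ hcharY hlim).toRecord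
          (h1LimConjMulAut (phi C) (D.lDeltaTheta l) (PiYdd C))
          (h1LimKummerOn (phi C) (D.lDeltaTheta l) (PiYdd C) c hA hfi O) iota).H)
    (hk : Function.Injective k)
    (hU : F.units.toSubmonoid.map k = ((thetaEnvData C hC hS hl hp2 hpl hζ mods f hf hmods h15 L hZ hcharY hlim).toRecord
          (h1LimConjMulAut (phi C) (D.lDeltaTheta l) (PiYdd C))
          (h1LimKummerOn (phi C) (D.lDeltaTheta l) (PiYdd C) c hA hfi O) iota).units.toSubmonoid)
    (α : (modelSystem C hC hS hl hp2 hpl hζ mods f hf hmods h15 L hZ).PiX) {i₀ : Iota}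
    (hθ : (k (F.conj α F.theta)) ∈ ((thetaEnvData C hC hS hl hp2 hpl hζ mods f hf hmods h15 L hZ hcharY hlim).toRecord
          (h1LimConjMulAut (phi C) (D.lDeltaTheta l) (PiYdd C))
          (h1LimKummerOn (phi C) (D.lDeltaTheta l) (PiYdd C) c hA hfi O) iota).thetaEnv i₀)
    (horb : ∀ θ' ∈ ((thetaEnvData C hC hS hl hp2 hpl hζ mods f hf hmods h15 L hZ hcharY hlim).toRecord
          (h1LimConjMulAut (phi C) (D.lDeltaTheta l) (PiYdd C))
          (h1LimKummerOn (phi C) (D.lDeltaTheta l) (PiYdd C) c hA hfi O) iota).thetaEnv i₀,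
      ∃ u ∈ ((thetaEnvData C hC hS hl hp2 hpl hζ mods f hf hmods h15 L hZ hcharY hlim).toRecord
          (h1LimConjMulAut (phi C) (D.lDeltaTheta l) (PiYdd C))
          (h1LimKummerOn (phi C) (D.lDeltaTheta l) (PiYdd C) c hA hfi O) iota).units, θ' = u * (k (F.conj α F.theta)))
    (R : Lbl → (((thetaEnvData C hC hS hl hp2 hpl hζ mods f hf hmods h15 L hZ hcharY hlim).toRecord
          (h1LimConjMulAut (phi C) (D.lDeltaTheta l) (PiYdd C))
          (h1LimKummerOn (phi C) (D.lDeltaTheta l) (PiYdd C) c hA hfi O) iota).H →*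
      Multiplicative (h1Lim φ₀ (D.lDeltaTheta l) (⊤ : Subgroup P₀) ⊥)))
    (hR : ∀ t y, Multiplicative.toAdd (R t y) =
      h1LimCongr (D.lDeltaTheta l) ⊤ (hφ t) ⊥
        (h1LimComap (phi C) (D.lDeltaTheta l) ((MonoidHom.id (Pi C)).comp (s t)) (hι t) (hN t)
          (AddEquiv.additiveMultiplicative (h1Lim (phi C) (D.lDeltaTheta l) (PiYdd C) ⊥) (Additive.ofMul y))))
    (ev : Lbl → (Afun →* (PadicAlgCl p)ˣ)) (hev : ∀ (t : Lbl) (g : P₀) (a : Afun), ev t (s t g • a) = g • ev t a)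
    (hcev : ∀ (t : Lbl) (ζ : cyclotome Afun), c₀.hom (cyclotome.map (ev t) ζ) = cf.hom ζ)
    {fΘ : Afun}
    (hθf : AddEquiv.additiveMultiplicative (h1Lim (phi C) (D.lDeltaTheta l) (PiYdd C) ⊥) (Additive.ofMul (k (F.conj α F.theta))) =
      Multiplicative.toAdd (h1LimKummer (phi C) (D.lDeltaTheta l) (PiYdd C) cf hAf hfif fΘ))
    (q : Lbl → O) (hval : ∀ t, ev t fΘ = (q t : (PadicAlgCl p)ˣ)) (t₀ : Lbl) (hq : ¬ IsUnit (q t₀)) :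
    ∃ (e : O ≃* MonoidHom.mrange (h1LimKummerOn φ₀ (D.lDeltaTheta l) ⊤ c₀ hA₀ hfi₀ O))
      (Φ : F.frobThetaMonoid α ≃*
        frobenioidGaussianMonoid e (fun t =>
          (fun t =>
          ((R t).comp (((thetaEnvData C hC hS hl hp2 hpl hζ mods f hf hmods h15 L hZ hcharY hlim).toRecord
          (h1LimConjMulAut (phi C) (D.lDeltaTheta l) (PiYdd C))
          (h1LimKummerOn (phi C) (D.lDeltaTheta l) (PiYdd C) c hA hfi O) iota).thetaMonoid i₀).subtype).codRestrict
            (MonoidHom.mrange (h1LimKummerOn φ₀ (D.lDeltaTheta l) ⊤ c₀ hA₀ hfi₀ O))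
            (restriction_mem_mrange_gen
              ((thetaEnvData C hC hS hl hp2 hpl hζ mods f hf hmods h15 L hZ hcharY hlim).toRecord
          (h1LimConjMulAut (phi C) (D.lDeltaTheta l) (PiYdd C))
          (h1LimKummerOn (phi C) (D.lDeltaTheta l) (PiYdd C) c hA hfi O) iota)
              (h1LimKummerOn (phi C) (D.lDeltaTheta l) (PiYdd C) c hA hfi O)
              (h1LimKummerOn φ₀ (D.lDeltaTheta l) ⊤ c₀ hA₀ hfi₀ O)
              (fun t => (R t).comp (((thetaEnvData C hC hS hl hp2 hpl hζ mods f hf hmods h15 L hZ hcharY hlim).toRecord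
          (h1LimConjMulAut (phi C) (D.lDeltaTheta l) (PiYdd C))
          (h1LimKummerOn (phi C) (D.lDeltaTheta l) (PiYdd C) c hA hfi O) iota).thetaMonoid i₀).subtype)
              q (hκ_padic C c hA hfi O hc) (ThetaEnvData.toRecord_constantMonoid _ _ _ _) hθ horb
              (fun t m hm => hRκ_toRecord C hC hS hl hp2 hpl hζ mods f hf hmods h15 L hZ hcharY hlim iota φ₀ s hι hN hφ c
                hA hfi O c₀ hA₀ hfi₀ hc₀c hact R hR t m hm)
              (fun t => hRθ_toRecord_of_evaluation C hC hS hl hp2 hpl hζ mods f hf hmods h15 L hZ hcharY hlim iota φ₀ s hι hN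
                hφ c hA hfi O c₀ hA₀ hfi₀ cf hAf hfif R hR ev hev hcev hθf q hval t) t)) t
            ⟨(k (F.conj α F.theta)), thetaEnv_subset_thetaMonoid
              ((thetaEnvData C hC hS hl hp2 hpl hζ mods f hf hmods h15 L hZ hcharY hlim).toRecord
          (h1LimConjMulAut (phi C) (D.lDeltaTheta l) (PiYdd C))
          (h1LimKummerOn (phi C) (D.lDeltaTheta l) (PiYdd C) c hA hfi O) iota) i₀ hθ⟩)),
      (∀ m : O, ((e m : MonoidHom.mrange (h1LimKummerOn φ₀ (D.lDeltaTheta l) ⊤ c₀ hA₀ hfi₀ O)) :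
          Multiplicative (h1Lim φ₀ (D.lDeltaTheta l) (⊤ : Subgroup P₀) ⊥)) = (h1LimKummerOn φ₀ (D.lDeltaTheta l) ⊤ c₀ hA₀ hfi₀ O) m) ∧
      ∀ (x : F.frobThetaMonoid α) (t : Lbl),
        (h1LimKummerOn φ₀ (D.lDeltaTheta l) ⊤ c₀ hA₀ hfi₀ O) (((Φ x : frobenioidGaussianMonoid e _) : Lbl → O) t) = R t (k x) := by
  have hκ₀ : Function.Injective (h1LimKummerOn φ₀ (D.lDeltaTheta l) ⊤ c₀ hA₀ hfi₀ O) :=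
    hκ₀_padic (C := C) (O := O) (φ₀ := φ₀) (s := s) (hι := hι) (c₀ := c₀) (hA₀ := hA₀) (hfi₀ := hfi₀) hc₀ t₁ (hact t₁)
  let e : O ≃* MonoidHom.mrange (h1LimKummerOn φ₀ (D.lDeltaTheta l) ⊤ c₀ hA₀ hfi₀ O) :=
    MulEquiv.ofBijective (h1LimKummerOn φ₀ (D.lDeltaTheta l) ⊤ c₀ hA₀ hfi₀ O).mrangeRestrict
      ⟨fun _ _ h => hκ₀ (congrArg Subtype.val h), (h1LimKummerOn φ₀ (D.lDeltaTheta l) ⊤ c₀ hA₀ hfi₀ O).mrangeRestrict_surjective⟩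
  obtain ⟨Φ, hΦ⟩ :=
    exists_transportIso_toRecord_padic_of_kummerMap_of_evaluation C hC hS hl hp2 hpl hζ mods f hf hmods h15 L hZ hcharY hlim iota φ₀ s hι hN hφ c hA hfi O c₀ hA₀ hfi₀
      cf hAf hfif hc hc₀ hc₀c hact t₁ F k hk hU α hθ horb R hR ev hev hcev hθf q hval t₀ hq e
  exact ⟨e, Φ, fun _ => rfl, fun x t => hΦ x t⟩

end EtaleLevels

end Literature.IUT.HodgeArakelov

end
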